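import Literature.Combinatorics.Additive.TripleProductPropertySAT
import Literature.Combinatorics.Additive.TPPGroupAlgebra
import HarnessLib

/-!
# Neumann's packing inequality for TPP triples: `|S| (|T| + |U| − 1) ≤ |G|`

Topic `Literature/Combinatorics/Additive` (triple product property, Cohn–Umans).  P. M. Neumann, *A note on the triple
product property for subsets of finite groups*, LMS J. Comput. Math. 14 (2011) 232–237 (held: `paper:neumann2011-…`, p. 234):

* **Observation 3.1.** "Let `(s₁, s₂, s₃)` be the parameters of a TPP triple in `G`. Then `s₁(s₂ + s₃ − 1) ≤ n`,
  `s₂(s₁ + s₃ − 1) ≤ n` and `s₃(s₁ + s₂ − 1) ≤ n`" (`n = |G|`).  PROVED here (`TripleProductProperty.card_mul_le_neumann`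
  and its two rotations), following the printed proof verbatim: w.l.o.g. the triple is basic (`1 ∈ S ∩ T ∩ U`, tree
  `exists_basic_tpp`, Hedtke–Murthy 2012 Lemma 2.9 / Neumann Obs. 2.1); then `(s, x) ↦ s⁻¹x` is injective on
  `S × (T ∪ U)` (three cases of the TPP relation), and `T ∩ U = {1}`.
  This sharpens the Cohn–Umans packing bound `|S||T| ≤ |G|` (tree `RealizesTPP.mul_le_card`) used throughout the ω-census
  family (b3); e.g. it alone shows that no group of order `8` realizes `⟨2,2,3⟩` and no group of order `10` realizes `⟨2,2,4⟩`
  or `⟨2,3,3⟩` (consumers: `Summits/MatrixMultiplication/OmegaCensus/`).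
* Not here: Observation 4.1 / Cor. 4.2 (`β(G) ≤ v³ β(H)`, `β(G) ≤ v²|G|` for an abelian subgroup of index `v`).
-/

namespace Literature.Combinatorics.Additive

open Finset

variable {G : Type*} [Group G] [DecidableEq G]

/-- In a BASIC TPP triple (`1 ∈ T`, `1 ∈ U`) the second and third sets meet only in `1` (Neumann 2011, §2: "if
`(S₁,S₂,S₃)` is a basic TPP triple and `i ≠ j`, then `Sᵢ ∩ Sⱼ = {1}`"). [cite: Neumann2011, Observation 2.1] -/
theorem TripleProductProperty.inter_eq_singleton_of_basic {S T U : Finset G} (h : TripleProductProperty S T U)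
    (hS : S.Nonempty) (hT1 : (1 : G) ∈ T) (hU1 : (1 : G) ∈ U) : T ∩ U = {1} := by
  ext x
  simp only [mem_inter, mem_singleton]
  constructor
  · rintro ⟨hxT, hxU⟩
    obtain ⟨s, hs⟩ := hS
    have key : s * s⁻¹ * (x * 1⁻¹) * (1 * x⁻¹) = 1 := by group
    exact (h s hs s hs x hxT 1 hT1 1 hU1 x hxU key).2.1
  · rintro rfl
    exact ⟨hT1, hU1⟩

/-- Injectivity behind Neumann's Observation 3.1: for a basic TPP triple, `(s, x) ↦ s⁻¹ x` is injective on `S × (T ∪ U)`.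
[cite: Neumann2011, Observation 3.1] -/
theorem TripleProductProperty.injOn_inv_mul_of_basic {S T U : Finset G} (h : TripleProductProperty S T U)
    (hT1 : (1 : G) ∈ T) (hU1 : (1 : G) ∈ U) :
    Set.InjOn (fun p : G × G => p.1⁻¹ * p.2) ↑(S ×ˢ (T ∪ U)) := by
  -- the case `x₁ ∈ T`, `x₂ ∈ T ∪ U` (and symmetric data) from the TPP relation `s₂ s₁⁻¹ · x₁ x₂⁻¹ = 1`
  have case : ∀ s₁ ∈ S, ∀ s₂ ∈ S, ∀ x₁ x₂ : G, s₁⁻¹ * x₁ = s₂⁻¹ * x₂ →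
      ((x₁ ∈ T ∧ x₂ ∈ T) ∨ (x₁ ∈ U ∧ x₂ ∈ U) ∨ (x₁ ∈ T ∧ x₂ ∈ U)) → s₁ = s₂ ∧ x₁ = x₂ := by
    intro s₁ hs₁ s₂ hs₂ x₁ x₂ he hx
    have rel : s₂ * s₁⁻¹ * x₁ * x₂⁻¹ = 1 := by
      have : x₁ = s₁ * (s₂⁻¹ * x₂) := by rw [← he]; group
      rw [this]; group
    rcases hx with ⟨h1, h2⟩ | ⟨h1, h2⟩ | ⟨h1, h2⟩
    · have key : s₂ * s₁⁻¹ * (x₁ * x₂⁻¹) * (1 * 1⁻¹) = 1 := by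
        simpa only [mul_assoc, one_mul, inv_one, mul_one] using rel
      obtain ⟨hs, hx, -⟩ := h s₂ hs₂ s₁ hs₁ x₁ h1 x₂ h2 1 hU1 1 hU1 key
      exact ⟨hs.symm, hx⟩
    · have key : s₂ * s₁⁻¹ * (1 * 1⁻¹) * (x₁ * x₂⁻¹) = 1 := by
        simpa only [mul_assoc, one_mul, inv_one, mul_one] using rel
      obtain ⟨hs, -, hx⟩ := h s₂ hs₂ s₁ hs₁ 1 hT1 1 hT1 x₁ h1 x₂ h2 key
      exact ⟨hs.symm, hx⟩
    · have key : s₂ * s₁⁻¹ * (x₁ * 1⁻¹) * (1 * x₂⁻¹) = 1 := by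
        simpa only [mul_assoc, one_mul, inv_one, mul_one] using rel
      obtain ⟨hs, hx1, hx2⟩ := h s₂ hs₂ s₁ hs₁ x₁ h1 1 hT1 1 hU1 x₂ h2 key
      exact ⟨hs.symm, by rw [hx1, ← hx2]⟩
  rintro ⟨s₁, x₁⟩ h₁ ⟨s₂, x₂⟩ h₂ he
  simp only [coe_product, coe_union, Set.mem_prod, mem_coe, Set.mem_union] at h₁ h₂
  simp only at he
  rcases h₁.2 with hx₁ | hx₁ <;> rcases h₂.2 with hx₂ | hx₂
  · obtain ⟨rfl, rfl⟩ := case s₁ h₁.1 s₂ h₂.1 x₁ x₂ he (Or.inl ⟨hx₁, hx₂⟩); rfl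
  · obtain ⟨rfl, rfl⟩ := case s₁ h₁.1 s₂ h₂.1 x₁ x₂ he (Or.inr (Or.inr ⟨hx₁, hx₂⟩)); rfl
  · obtain ⟨rfl, rfl⟩ := case s₂ h₂.1 s₁ h₁.1 x₂ x₁ he.symm (Or.inr (Or.inr ⟨hx₂, hx₁⟩)); rfl
  · obtain ⟨rfl, rfl⟩ := case s₁ h₁.1 s₂ h₂.1 x₁ x₂ he (Or.inr (Or.inl ⟨hx₁, hx₂⟩)); rfl

/-- **Neumann 2011, Observation 3.1 (basic triples).** If `(S, T, U)` is a TPP triple in a finite group `G` with `S ≠ ∅` and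
`1 ∈ T`, `1 ∈ U`, then `|S| · (|T| + |U| − 1) ≤ |G|`. [cite: Neumann2011, Observation 3.1] -/
theorem TripleProductProperty.card_mul_le_neumann_of_basic [Fintype G] {S T U : Finset G}
    (h : TripleProductProperty S T U) (hS : S.Nonempty) (hT1 : (1 : G) ∈ T) (hU1 : (1 : G) ∈ U) :
    S.card * (T.card + U.card - 1) ≤ Fintype.card G := by
  have hTU : (T ∪ U).card = T.card + U.card - 1 := by
    have := card_union_add_card_inter T U
    rw [h.inter_eq_singleton_of_basic hS hT1 hU1, card_singleton] at this
    omega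
  calc S.card * (T.card + U.card - 1) = (S ×ˢ (T ∪ U)).card := by rw [card_product, hTU]
    _ = ((S ×ˢ (T ∪ U)).image fun p : G × G => p.1⁻¹ * p.2).card :=
        (card_image_of_injOn (h.injOn_inv_mul_of_basic hT1 hU1)).symm
    _ ≤ Fintype.card G := card_le_univ _

/-- **Neumann 2011, Observation 3.1.** "Let `(s₁, s₂, s₃)` be the parameters of a TPP triple in `G`. Then
`s₁(s₂ + s₃ − 1) ≤ n`" — for every TPP triple `(S, T, U)` of NONEMPTY finite subsets of a finite group `G`,
`|S| · (|T| + |U| − 1) ≤ |G|` (translate to a basic triple first, Obs. 2.1 / tree `exists_basic_tpp`).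
[cite: Neumann2011, Observation 3.1] -/
theorem TripleProductProperty.card_mul_le_neumann [Fintype G] {S T U : Finset G} (h : TripleProductProperty S T U)
    (hS : S.Nonempty) (hT : T.Nonempty) (hU : U.Nonempty) :
    S.card * (T.card + U.card - 1) ≤ Fintype.card G := by
  obtain ⟨S', T', U', h', -, hT1, hU1, hcS, hcT, hcU⟩ := exists_basic_tpp h hS hT hU
  have hS' : S'.Nonempty := by rw [← card_pos, hcS]; exact card_pos.2 hS
  have := h'.card_mul_le_neumann_of_basic hS' hT1 hU1
  rwa [hcS, hcT, hcU] at this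

/-- Neumann's Observation 3.1, second inequality: `|T| · (|U| + |S| − 1) ≤ |G|` (cyclic rotation of the triple,
tree `TripleProductProperty.rotate`). [cite: Neumann2011, Observation 3.1] -/
theorem TripleProductProperty.card_mul_le_neumann₂ [Fintype G] {S T U : Finset G} (h : TripleProductProperty S T U)
    (hS : S.Nonempty) (hT : T.Nonempty) (hU : U.Nonempty) :
    T.card * (U.card + S.card - 1) ≤ Fintype.card G :=
  h.rotate.card_mul_le_neumann hT hU hS

/-- Neumann's Observation 3.1, third inequality: `|U| · (|S| + |T| − 1) ≤ |G|`. [cite: Neumann2011, Observation 3.1] -/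
theorem TripleProductProperty.card_mul_le_neumann₃ [Fintype G] {S T U : Finset G} (h : TripleProductProperty S T U)
    (hS : S.Nonempty) (hT : T.Nonempty) (hU : U.Nonempty) :
    U.card * (S.card + T.card - 1) ≤ Fintype.card G :=
  h.rotate.rotate.card_mul_le_neumann hU hS hT

end Literature.Combinatorics.Additive
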